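import Summits.CriticalPhenomena.SAWScalingLimit.Theses.SAWTensorRG
import Summits.CriticalPhenomena.SAWScalingLimit.Theorems.SAWTensorRGConformalAvoidanceApproxIndependent
import Summits.CriticalPhenomena.SAWScalingLimit.Theorems.SAWTensorRGConformalAvoidanceTranslation
import Summits.CriticalPhenomena.SAWScalingLimit.Theorems.SAWTensorRGConformalAvoidanceDilation
import Summits.CriticalPhenomena.SAWScalingLimit.Theorems.SAWTensorRGConformalAvoidanceQuarterTurn
import Literature.Probability.RandomPlanarGeometry.SAWScalingLimitFamily

/-!
# Skeleton of line `birth` for the crux `ConformalAvoidance` of route `SAWTensorRG` — lead's reshape r5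
(item stmt-CriticalPhenomena-7605, rank 2, sub-problem `SAWScalingLimit`; lead prover-line-stmt-CriticalPhenomena-7605-0, continued by lead prover-line-stmt-CriticalPhenomena-7605-c1-0)

Crux (by name): `Summit.CriticalPhenomena.SAWScalingLimit.Theses.SAWTensorRG.ConformalAvoidance` — for
hull-subdomain pairs `D ⊇ D'`, `E ⊇ E'` (same marked points, agreeing in balls around them), endpoint
approximations `(a_δ, b_δ)` of `D` and `(c_δ, d_δ)` of `E`, and a conformal `g : D → E` with boundary
values `a ↦ E.pt 0`, `b ↦ E.pt 1` and `g(D') = E'`, there is ONE `r ∈ [0, ∞]` with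
`P_δ^D(range γ ⊆ cl D') → r` and `P_δ^E(range γ ⊆ cl E') → r` along the full filter `δ → 0+`.

## The line (birth = the route's two-layer plan), reshaped by the lead (r1, 2026-08-17)

The birth skeleton had three stubs: EXISTENCE (`stub_avoidanceLimitExists`), SIMILARITY INVARIANCE of
the limit values (`stub_similarityInvariantLimits`, all plane similarities `z ↦ s e^{iθ} z + w`) and the
residual N3 (`stub_conformalOfSimilarity`). Most of the similarity stub is NOT engine work: once the
limits exist for EVERY endpoint approximation (stub 1),

* approximation independence follows by INTERLEAVING two approximations (a third approximation that
  is `(a, b)` on a set of meshes accumulating at `0` and `(c, d)` on its complement has a limit too);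
* dilation invariance `z ↦ s z` follows from the exact lattice identity `(sΩ)_δ = s · Ω_{δ/s}`
  (`map_curve_law_dilate`, `isEndpointApprox_dilate` of `SAWConePseudogroupLatticeSimilarityOfLimitTransport`)
  and approximation independence;
* translation invariance `z ↦ z + w` (ANY `w ∈ ℂ`, not only lattice vectors) follows from the exact
  identity at the meshes `δₙ = |Re w|/(n+1)` (then `|Im w|/(n+1)`) where the translation is a lattice
  vector (`map_curve_law_translate`, `isEndpointApprox_splice`, `exists_mesh_seq`), existence of the
  full-filter limit for the spliced approximation (stub 1) and uniqueness of limits along a sequence.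

What remains of similarity invariance is ROTATION invariance `z ↦ e^{iθ} z` — the emergent isotropy
the tensor-RG engine is meant to deliver (EbelKennedyRychkov2025Rotations, arXiv:2408.10312 §2.3:
"the anisotropy ellipse is a circle"; quarter turns are exact lattice symmetries but no finite set of
exact symmetries generates a generic rotation). Hence SIX registered stubs (`stubs_max = 7`; r1 had a seventh,
`stub_similarityOfParts`, whose literal signature (5767 chars) exceeds the ledger's stored-signature cap of
3900 chars and could therefore never be matched by a `--supports` file — r2 proves it inside this file as the
glue `similarityInvariantLimits_of_parts` instead; r2 also prepends existence + approximation independence to the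
rotation stub, which at `θ = 0` would otherwise assert approximation independence unconditionally — wave-1 worker
finding `stub-misstated`, 2026-08-17; r3 finally splits the rotation stub into the EXACT lattice symmetry —
quarter turns, `stub_quarterTurnInvariantLimits`, provable now from `stub_quarterTurnCovariance` — and rotations
by `θ ∈ [0, π/2)`, the glue `rotationInvariantLimits_of_parts` recombining them through `θ = ⌊θ/(π/2)⌋·(π/2) + θ'`,
`e^{iθ} = e^{iθ'} · i^{k mod 4}`; seven stubs again; r4 IMPORTS the stubs that have LANDED as `Theorems/` files — `stub_approxIndependentLimits`, `stub_translationInvariantLimits`, `stub_dilationInvariantLimits`, `stub_quarterTurnInvariantLimits` — and drops them from the registered set, their `sorry`s replaced by the tree theorems):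

1. `stub_avoidanceLimitExists` (XL, open; engine deliverable 1) — unchanged.
2a. `stub_approxIndependentLimits` (S, provable now) — existence ⇒ approximation independence.
2b. `stub_translationInvariantLimits` (M, provable now) — existence + approximation independence ⇒
    invariance of the limit values under `z ↦ z + w`, every `w ∈ ℂ`.
2c. `stub_dilationInvariantLimits` (S/M, provable now) — approximation independence ⇒ invariance under
    `z ↦ s z`, `s > 0`.
2q. `stub_quarterTurnInvariantLimits` (S/M, provable now) — approximation independence ⇒ invariance under
    the quarter turn `z ↦ i z` (exact automorphism `(x, y) ↦ (-y, x)` of `δℤ²`: `stub_quarterTurnCovariance`).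
2d. `stub_rotationInvariantLimits` (XL, open; engine deliverable 2 proper, now SHARP) — existence +
    approximation independence ⇒ invariance under `z ↦ e^{iθ} z` for `θ ∈ [0, π/2)` (at `θ = 0` it is the
    hypothesis; every `θ ∈ (0, π/2)` is the emergent isotropy of the critical ℤ² SAW — nothing in print).
3. `stub_conformalOfSimilarity` (XXL, open; the HARDEST, held by the lead) — unchanged: existence +
   similarity invariance ⇒ conformal invariance (model-specific N3; NOT the model-blind upgrade refuted
   by `Literature.Barriers.CriticalPhenomena.ScaleCovarianceNotMoebius`).

In 2b–2d the second configuration `(E, E')` is ANY pair of Dobrushin domains whose carriers are the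
images of `D, D'` under the plane similarity and whose marked points are the images of those of `D`
(the marked points of a `MarkedDomain` are not determined by its carrier; they enter through the endpoint
approximation `(c, d)` and the hull clauses of `(E, E')`, which are kept verbatim).

PROVED here (no `sorry`): `invariantUnder_I_pow` (1 + 2a + 2q ⇒ invariance under `z ↦ iᵐ z`, induction on
`m` through the intermediate domains `iᵐ D`), `rotationInvariantLimits_of_parts` (1 + 2a + 2q + 2d ⇒ invariance
under every rotation, `θ = ⌊θ/(π/2)⌋·(π/2) + θ'`), `similarityInvariantLimits_of_parts` — all parts ⇒ stub 2 of the
birth skeleton (`SimilarityInvariantLimits`): factor `g = (· + w) ∘ (s ·) ∘ (e^{iθ} ·)` through the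
intermediate marked domains `e^{iθ} D`, `s e^{iθ} D` (`MarkedDomain.map`; hull clauses transported by
`hull_map`, endpoint approximations by `SAW.exists_isEndpointApprox`, limits by stub 1), chain the three
invariances, and read the marked points of `E` off the boundary values of `g`
(`eq_of_hasBoundaryValue_of_eqOn`) — and the composition `ConformalAvoidance_of` (stubs ⇒ crux BY NAME).

The `stub_*` statements are LITERAL (self-contained over tree declarations under the `open`s below) so
that the registered signatures can be restated verbatim in a `Theorems/` file; `§1` names them and
`example`s check literal = named by term identity.

Disproof.lean: none exists for this crux (`ledger crux ls`, 2026-08-17). Negatives index: untouched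
(no tightness clause; no stub drops the ε-ball / boundary-value / image clauses — cf. the
`Theorems/AvoidanceLimit/Negative/` lane of the sibling crux stmt-CriticalPhenomena-10649, whose kill
criteria also show that no probability-0 / probability-1 lattice refutation of stub 1 exists along
endpoint approximations).

Sources: LawlerSchrammWerner2004SAW §3.4.2, §4.1; LawlerSchrammWerner2003Restriction; Kennedy2002;
EbelKennedyRychkov2025Rotations (arXiv:2408.10312 §2.3, §4.1); Beffara2008Universal §2.2 (lattice
symmetries of scaling limits); Billingsley1999 Thm 1.2 (uniqueness of weak limits).
-/

noncomputable section

open scoped Topology ENNReal NNReal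
open Filter Set MeasureTheory
open Literature.Probability.RandomPlanarGeometry Literature.Probability.LatticeModels
open Summit.CriticalPhenomena.SAWScalingLimit.Theses.SAWTensorRG (ConformalAvoidance)

namespace Summit.CriticalPhenomena.SAWScalingLimit.Cruxes.ConformalAvoidance.Birth

/-! ## 1. The statements of the line (over tree declarations only) -/

/-- **AvoidanceLimitExists** (engine deliverable 1): for every hull-subdomain pair `D ⊇ D'` of Dobrushin
domains (same marked points, agreeing in balls around them) and every endpoint approximation `(a_δ, b_δ)`
of `D`, the critical-SAW avoidance probability `P_δ(range γ ⊆ closure D')` converges as `δ → 0+` (full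
filter) to some `r ∈ [0, ∞]`. [cite: LawlerSchrammWerner2004SAW, §3.4.2] -/
def AvoidanceLimitExists : Prop :=
  ∀ (D D' : DobrushinDomain) (a b : ℝ → Site 2), SAW.IsEndpointApprox D a b →
    D'.carrier ⊆ D.carrier → D'.pt 0 = D.pt 0 → D'.pt 1 = D.pt 1 →
    (∃ ε : ℝ, 0 < ε ∧ D'.carrier ∩ Metric.ball (D.pt 0) ε = D.carrier ∩ Metric.ball (D.pt 0) ε ∧
      D'.carrier ∩ Metric.ball (D.pt 1) ε = D.carrier ∩ Metric.ball (D.pt 1) ε) →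
    ∃ r : ENNReal,
      Tendsto (fun δ => ((SAW.law D.carrier δ (a δ) (b δ)).map (fun γ => γ.curve))
          (CurveClass.rangeSubset (closure D'.carrier))) (𝓝[>] 0) (𝓝 r)

/-- **ApproxIndependentLimits**: two endpoint approximations of the same hull pair give the same limit
(whenever both limits exist). [folklore] -/
def ApproxIndependentLimits : Prop :=
  ∀ (D D' : DobrushinDomain) (a b c d : ℝ → Site 2),
    SAW.IsEndpointApprox D a b → SAW.IsEndpointApprox D c d →
    D'.carrier ⊆ D.carrier → D'.pt 0 = D.pt 0 → D'.pt 1 = D.pt 1 →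
    (∃ ε : ℝ, 0 < ε ∧ D'.carrier ∩ Metric.ball (D.pt 0) ε = D.carrier ∩ Metric.ball (D.pt 0) ε ∧
      D'.carrier ∩ Metric.ball (D.pt 1) ε = D.carrier ∩ Metric.ball (D.pt 1) ε) →
    ∀ r₁ r₂ : ENNReal,
      Tendsto (fun δ => ((SAW.law D.carrier δ (a δ) (b δ)).map (fun γ => γ.curve))
          (CurveClass.rangeSubset (closure D'.carrier))) (𝓝[>] 0) (𝓝 r₁) →
      Tendsto (fun δ => ((SAW.law D.carrier δ (c δ) (d δ)).map (fun γ => γ.curve))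
          (CurveClass.rangeSubset (closure D'.carrier))) (𝓝[>] 0) (𝓝 r₂) → r₁ = r₂

/-- **TranslationInvariantLimits**: limit values agree across two configurations related by a plane
translation `z ↦ z + w` (carriers AND marked points transported). [cite: LawlerSchrammWerner2004SAW, §3.4.2] -/
def TranslationInvariantLimits : Prop :=
  ∀ (D D' E E' : DobrushinDomain) (a b c d : ℝ → Site 2) (w : ℂ),
    SAW.IsEndpointApprox D a b → SAW.IsEndpointApprox E c d →
    D'.carrier ⊆ D.carrier → D'.pt 0 = D.pt 0 → D'.pt 1 = D.pt 1 →
    (∃ ε : ℝ, 0 < ε ∧ D'.carrier ∩ Metric.ball (D.pt 0) ε = D.carrier ∩ Metric.ball (D.pt 0) ε ∧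
      D'.carrier ∩ Metric.ball (D.pt 1) ε = D.carrier ∩ Metric.ball (D.pt 1) ε) →
    E'.carrier ⊆ E.carrier → E'.pt 0 = E.pt 0 → E'.pt 1 = E.pt 1 →
    (∃ ε : ℝ, 0 < ε ∧ E'.carrier ∩ Metric.ball (E.pt 0) ε = E.carrier ∩ Metric.ball (E.pt 0) ε ∧
      E'.carrier ∩ Metric.ball (E.pt 1) ε = E.carrier ∩ Metric.ball (E.pt 1) ε) →
    E.carrier = (similarity 1 one_ne_zero w) '' D.carrier →
    E'.carrier = (similarity 1 one_ne_zero w) '' D'.carrier →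
    E.pt 0 = (similarity 1 one_ne_zero w) (D.pt 0) → E.pt 1 = (similarity 1 one_ne_zero w) (D.pt 1) →
    ∀ r₁ r₂ : ENNReal,
      Tendsto (fun δ => ((SAW.law D.carrier δ (a δ) (b δ)).map (fun γ => γ.curve))
          (CurveClass.rangeSubset (closure D'.carrier))) (𝓝[>] 0) (𝓝 r₁) →
      Tendsto (fun δ => ((SAW.law E.carrier δ (c δ) (d δ)).map (fun γ => γ.curve))
          (CurveClass.rangeSubset (closure E'.carrier))) (𝓝[>] 0) (𝓝 r₂) → r₁ = r₂

/-- **DilationInvariantLimits**: limit values agree across two configurations related by a dilation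
`z ↦ s z`, `s > 0`. [cite: LawlerSchrammWerner2004SAW, §3.4.2] -/
def DilationInvariantLimits : Prop :=
  ∀ (D D' E E' : DobrushinDomain) (a b c d : ℝ → Site 2) (s : ℝ) (hs : (s : ℂ) ≠ 0),
    0 < s →
    SAW.IsEndpointApprox D a b → SAW.IsEndpointApprox E c d →
    D'.carrier ⊆ D.carrier → D'.pt 0 = D.pt 0 → D'.pt 1 = D.pt 1 →
    (∃ ε : ℝ, 0 < ε ∧ D'.carrier ∩ Metric.ball (D.pt 0) ε = D.carrier ∩ Metric.ball (D.pt 0) ε ∧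
      D'.carrier ∩ Metric.ball (D.pt 1) ε = D.carrier ∩ Metric.ball (D.pt 1) ε) →
    E'.carrier ⊆ E.carrier → E'.pt 0 = E.pt 0 → E'.pt 1 = E.pt 1 →
    (∃ ε : ℝ, 0 < ε ∧ E'.carrier ∩ Metric.ball (E.pt 0) ε = E.carrier ∩ Metric.ball (E.pt 0) ε ∧
      E'.carrier ∩ Metric.ball (E.pt 1) ε = E.carrier ∩ Metric.ball (E.pt 1) ε) →
    E.carrier = (similarity (s : ℂ) hs 0) '' D.carrier →
    E'.carrier = (similarity (s : ℂ) hs 0) '' D'.carrier →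
    E.pt 0 = (similarity (s : ℂ) hs 0) (D.pt 0) → E.pt 1 = (similarity (s : ℂ) hs 0) (D.pt 1) →
    ∀ r₁ r₂ : ENNReal,
      Tendsto (fun δ => ((SAW.law D.carrier δ (a δ) (b δ)).map (fun γ => γ.curve))
          (CurveClass.rangeSubset (closure D'.carrier))) (𝓝[>] 0) (𝓝 r₁) →
      Tendsto (fun δ => ((SAW.law E.carrier δ (c δ) (d δ)).map (fun γ => γ.curve))
          (CurveClass.rangeSubset (closure E'.carrier))) (𝓝[>] 0) (𝓝 r₂) → r₁ = r₂

/-- **InvariantUnder c**: limit values agree across two configurations related by the linear similarity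
`z ↦ κ z` (`κ ≠ 0`; carriers AND marked points transported). Glue vocabulary of this file. [folklore] -/
def InvariantUnder (κ : ℂ) (hκ : κ ≠ 0) : Prop :=
  ∀ (D D' E E' : DobrushinDomain) (a b c d : ℝ → Site 2),
    SAW.IsEndpointApprox D a b → SAW.IsEndpointApprox E c d →
    D'.carrier ⊆ D.carrier → D'.pt 0 = D.pt 0 → D'.pt 1 = D.pt 1 →
    (∃ ε : ℝ, 0 < ε ∧ D'.carrier ∩ Metric.ball (D.pt 0) ε = D.carrier ∩ Metric.ball (D.pt 0) ε ∧
      D'.carrier ∩ Metric.ball (D.pt 1) ε = D.carrier ∩ Metric.ball (D.pt 1) ε) →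
    E'.carrier ⊆ E.carrier → E'.pt 0 = E.pt 0 → E'.pt 1 = E.pt 1 →
    (∃ ε : ℝ, 0 < ε ∧ E'.carrier ∩ Metric.ball (E.pt 0) ε = E.carrier ∩ Metric.ball (E.pt 0) ε ∧
      E'.carrier ∩ Metric.ball (E.pt 1) ε = E.carrier ∩ Metric.ball (E.pt 1) ε) →
    E.carrier = (similarity κ hκ 0) '' D.carrier →
    E'.carrier = (similarity κ hκ 0) '' D'.carrier →
    E.pt 0 = (similarity κ hκ 0) (D.pt 0) → E.pt 1 = (similarity κ hκ 0) (D.pt 1) →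
    ∀ r₁ r₂ : ENNReal,
      Tendsto (fun δ => ((SAW.law D.carrier δ (a δ) (b δ)).map (fun γ => γ.curve))
          (CurveClass.rangeSubset (closure D'.carrier))) (𝓝[>] 0) (𝓝 r₁) →
      Tendsto (fun δ => ((SAW.law E.carrier δ (c δ) (d δ)).map (fun γ => γ.curve))
          (CurveClass.rangeSubset (closure E'.carrier))) (𝓝[>] 0) (𝓝 r₂) → r₁ = r₂

/-- **QuarterTurnInvariantLimits**: limit values agree across two configurations related by the quarter turn
`z ↦ i z` (an exact symmetry of every `δℤ²`). [cite: Beffara2008Universal, §2.2] -/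
def QuarterTurnInvariantLimits : Prop :=
  ∀ (D D' E E' : DobrushinDomain) (a b c d : ℝ → Site 2),
    SAW.IsEndpointApprox D a b → SAW.IsEndpointApprox E c d →
    D'.carrier ⊆ D.carrier → D'.pt 0 = D.pt 0 → D'.pt 1 = D.pt 1 →
    (∃ ε : ℝ, 0 < ε ∧ D'.carrier ∩ Metric.ball (D.pt 0) ε = D.carrier ∩ Metric.ball (D.pt 0) ε ∧
      D'.carrier ∩ Metric.ball (D.pt 1) ε = D.carrier ∩ Metric.ball (D.pt 1) ε) →
    E'.carrier ⊆ E.carrier → E'.pt 0 = E.pt 0 → E'.pt 1 = E.pt 1 →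
    (∃ ε : ℝ, 0 < ε ∧ E'.carrier ∩ Metric.ball (E.pt 0) ε = E.carrier ∩ Metric.ball (E.pt 0) ε ∧
      E'.carrier ∩ Metric.ball (E.pt 1) ε = E.carrier ∩ Metric.ball (E.pt 1) ε) →
    E.carrier = (similarity Complex.I Complex.I_ne_zero 0) '' D.carrier →
    E'.carrier = (similarity Complex.I Complex.I_ne_zero 0) '' D'.carrier →
    E.pt 0 = (similarity Complex.I Complex.I_ne_zero 0) (D.pt 0) → E.pt 1 = (similarity Complex.I Complex.I_ne_zero 0) (D.pt 1) →
    ∀ r₁ r₂ : ENNReal,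
      Tendsto (fun δ => ((SAW.law D.carrier δ (a δ) (b δ)).map (fun γ => γ.curve))
          (CurveClass.rangeSubset (closure D'.carrier))) (𝓝[>] 0) (𝓝 r₁) →
      Tendsto (fun δ => ((SAW.law E.carrier δ (c δ) (d δ)).map (fun γ => γ.curve))
          (CurveClass.rangeSubset (closure E'.carrier))) (𝓝[>] 0) (𝓝 r₂) → r₁ = r₂

/-- **AcuteRotationInvariantLimits** (engine deliverable 2 proper, the emergent isotropy, SHARP form): limit
values agree across two configurations related by a rotation `z ↦ e^{iθ} z` with `θ ∈ [0, π/2)`.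
[cite: arXiv:2408.10312, §2.3] -/
def AcuteRotationInvariantLimits : Prop :=
  ∀ (D D' E E' : DobrushinDomain) (a b c d : ℝ → Site 2) (θ : ℝ) (hθ : Complex.exp ((θ : ℂ) * Complex.I) ≠ 0),
    0 ≤ θ → θ < Real.pi / 2 →
    SAW.IsEndpointApprox D a b → SAW.IsEndpointApprox E c d →
    D'.carrier ⊆ D.carrier → D'.pt 0 = D.pt 0 → D'.pt 1 = D.pt 1 →
    (∃ ε : ℝ, 0 < ε ∧ D'.carrier ∩ Metric.ball (D.pt 0) ε = D.carrier ∩ Metric.ball (D.pt 0) ε ∧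
      D'.carrier ∩ Metric.ball (D.pt 1) ε = D.carrier ∩ Metric.ball (D.pt 1) ε) →
    E'.carrier ⊆ E.carrier → E'.pt 0 = E.pt 0 → E'.pt 1 = E.pt 1 →
    (∃ ε : ℝ, 0 < ε ∧ E'.carrier ∩ Metric.ball (E.pt 0) ε = E.carrier ∩ Metric.ball (E.pt 0) ε ∧
      E'.carrier ∩ Metric.ball (E.pt 1) ε = E.carrier ∩ Metric.ball (E.pt 1) ε) →
    E.carrier = (similarity (Complex.exp ((θ : ℂ) * Complex.I)) hθ 0) '' D.carrier →
    E'.carrier = (similarity (Complex.exp ((θ : ℂ) * Complex.I)) hθ 0) '' D'.carrier →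
    E.pt 0 = (similarity (Complex.exp ((θ : ℂ) * Complex.I)) hθ 0) (D.pt 0) → E.pt 1 = (similarity (Complex.exp ((θ : ℂ) * Complex.I)) hθ 0) (D.pt 1) →
    ∀ r₁ r₂ : ENNReal,
      Tendsto (fun δ => ((SAW.law D.carrier δ (a δ) (b δ)).map (fun γ => γ.curve))
          (CurveClass.rangeSubset (closure D'.carrier))) (𝓝[>] 0) (𝓝 r₁) →
      Tendsto (fun δ => ((SAW.law E.carrier δ (c δ) (d δ)).map (fun γ => γ.curve))
          (CurveClass.rangeSubset (closure E'.carrier))) (𝓝[>] 0) (𝓝 r₂) → r₁ = r₂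

/-- **RotationInvariantLimits** (derived): limit values agree across two configurations related by a rotation
`z ↦ e^{iθ} z`, every `θ ∈ ℝ`. [cite: arXiv:2408.10312, §2.3] -/
def RotationInvariantLimits : Prop :=
  ∀ (D D' E E' : DobrushinDomain) (a b c d : ℝ → Site 2) (θ : ℝ) (hθ : Complex.exp ((θ : ℂ) * Complex.I) ≠ 0),
    SAW.IsEndpointApprox D a b → SAW.IsEndpointApprox E c d →
    D'.carrier ⊆ D.carrier → D'.pt 0 = D.pt 0 → D'.pt 1 = D.pt 1 →
    (∃ ε : ℝ, 0 < ε ∧ D'.carrier ∩ Metric.ball (D.pt 0) ε = D.carrier ∩ Metric.ball (D.pt 0) ε ∧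
      D'.carrier ∩ Metric.ball (D.pt 1) ε = D.carrier ∩ Metric.ball (D.pt 1) ε) →
    E'.carrier ⊆ E.carrier → E'.pt 0 = E.pt 0 → E'.pt 1 = E.pt 1 →
    (∃ ε : ℝ, 0 < ε ∧ E'.carrier ∩ Metric.ball (E.pt 0) ε = E.carrier ∩ Metric.ball (E.pt 0) ε ∧
      E'.carrier ∩ Metric.ball (E.pt 1) ε = E.carrier ∩ Metric.ball (E.pt 1) ε) →
    E.carrier = (similarity (Complex.exp ((θ : ℂ) * Complex.I)) hθ 0) '' D.carrier →
    E'.carrier = (similarity (Complex.exp ((θ : ℂ) * Complex.I)) hθ 0) '' D'.carrier →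
    E.pt 0 = (similarity (Complex.exp ((θ : ℂ) * Complex.I)) hθ 0) (D.pt 0) → E.pt 1 = (similarity (Complex.exp ((θ : ℂ) * Complex.I)) hθ 0) (D.pt 1) →
    ∀ r₁ r₂ : ENNReal,
      Tendsto (fun δ => ((SAW.law D.carrier δ (a δ) (b δ)).map (fun γ => γ.curve))
          (CurveClass.rangeSubset (closure D'.carrier))) (𝓝[>] 0) (𝓝 r₁) →
      Tendsto (fun δ => ((SAW.law E.carrier δ (c δ) (d δ)).map (fun γ => γ.curve))
          (CurveClass.rangeSubset (closure E'.carrier))) (𝓝[>] 0) (𝓝 r₂) → r₁ = r₂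

/-- **SimilarityInvariantLimits** (stub 2 of the birth skeleton, now DERIVED): for two crux configurations
related by a conformal `g : D → E` that is a SIMILARITY `z ↦ s e^{iθ} z + w` on `D`, with the crux's
boundary data, any two limits coincide. [cite: arXiv:2408.10312, §2.3] -/
def SimilarityInvariantLimits : Prop :=
  ∀ (D D' E E' : DobrushinDomain) (a b c d : ℝ → Site 2) (g : ConformalEquiv D.carrier E.carrier),
    (∃ (s θ : ℝ) (w : ℂ), 0 < s ∧ ∀ z ∈ D.carrier,
      g z = (s : ℂ) * Complex.exp ((θ : ℂ) * Complex.I) * z + w) →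
    SAW.IsEndpointApprox D a b → SAW.IsEndpointApprox E c d →
    D'.carrier ⊆ D.carrier → D'.pt 0 = D.pt 0 → D'.pt 1 = D.pt 1 →
    (∃ ε : ℝ, 0 < ε ∧ D'.carrier ∩ Metric.ball (D.pt 0) ε = D.carrier ∩ Metric.ball (D.pt 0) ε ∧
      D'.carrier ∩ Metric.ball (D.pt 1) ε = D.carrier ∩ Metric.ball (D.pt 1) ε) →
    E'.carrier ⊆ E.carrier → E'.pt 0 = E.pt 0 → E'.pt 1 = E.pt 1 →
    (∃ ε : ℝ, 0 < ε ∧ E'.carrier ∩ Metric.ball (E.pt 0) ε = E.carrier ∩ Metric.ball (E.pt 0) ε ∧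
      E'.carrier ∩ Metric.ball (E.pt 1) ε = E.carrier ∩ Metric.ball (E.pt 1) ε) →
    g.HasBoundaryValue (D.pt 0) (E.pt 0) → g.HasBoundaryValue (D.pt 1) (E.pt 1) →
    g '' D'.carrier = E'.carrier →
    ∀ r₁ r₂ : ENNReal,
      Tendsto (fun δ => ((SAW.law D.carrier δ (a δ) (b δ)).map (fun γ => γ.curve))
          (CurveClass.rangeSubset (closure D'.carrier))) (𝓝[>] 0) (𝓝 r₁) →
      Tendsto (fun δ => ((SAW.law E.carrier δ (c δ) (d δ)).map (fun γ => γ.curve))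
          (CurveClass.rangeSubset (closure E'.carrier))) (𝓝[>] 0) (𝓝 r₂) → r₁ = r₂

/-- **ConformallyInvariantLimits** (the invariance half of the crux, value-free): the same coincidence of
limits for EVERY conformal `g : D → E` with the crux's boundary data. [cite: LawlerSchrammWerner2004SAW, §4.1] -/
def ConformallyInvariantLimits : Prop :=
  ∀ (D D' E E' : DobrushinDomain) (a b c d : ℝ → Site 2) (g : ConformalEquiv D.carrier E.carrier),
    SAW.IsEndpointApprox D a b → SAW.IsEndpointApprox E c d →
    D'.carrier ⊆ D.carrier → D'.pt 0 = D.pt 0 → D'.pt 1 = D.pt 1 →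
    (∃ ε : ℝ, 0 < ε ∧ D'.carrier ∩ Metric.ball (D.pt 0) ε = D.carrier ∩ Metric.ball (D.pt 0) ε ∧
      D'.carrier ∩ Metric.ball (D.pt 1) ε = D.carrier ∩ Metric.ball (D.pt 1) ε) →
    E'.carrier ⊆ E.carrier → E'.pt 0 = E.pt 0 → E'.pt 1 = E.pt 1 →
    (∃ ε : ℝ, 0 < ε ∧ E'.carrier ∩ Metric.ball (E.pt 0) ε = E.carrier ∩ Metric.ball (E.pt 0) ε ∧
      E'.carrier ∩ Metric.ball (E.pt 1) ε = E.carrier ∩ Metric.ball (E.pt 1) ε) →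
    g.HasBoundaryValue (D.pt 0) (E.pt 0) → g.HasBoundaryValue (D.pt 1) (E.pt 1) →
    g '' D'.carrier = E'.carrier →
    ∀ r₁ r₂ : ENNReal,
      Tendsto (fun δ => ((SAW.law D.carrier δ (a δ) (b δ)).map (fun γ => γ.curve))
          (CurveClass.rangeSubset (closure D'.carrier))) (𝓝[>] 0) (𝓝 r₁) →
      Tendsto (fun δ => ((SAW.law E.carrier δ (c δ) (d δ)).map (fun γ => γ.curve))
          (CurveClass.rangeSubset (closure E'.carrier))) (𝓝[>] 0) (𝓝 r₂) → r₁ = r₂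

/-- **ConformalOfSimilarity** (the residual N3 of card certified-tensor-rg-n0-vertex-model): existence plus
similarity invariance of the SAW hull-avoidance limits imply their conformal invariance. -/
def ConformalOfSimilarity : Prop :=
  AvoidanceLimitExists → SimilarityInvariantLimits → ConformallyInvariantLimits

/-! ## 2. Registered stubs -/

/-! The `stub_*` theorems are the registered obligations (sorried; statements LITERAL so that the registered
signatures are self-contained); `Registered.stub_*` are the name-keyed `abbrev` aliases of their statements,
used as the hypotheses of `ConformalAvoidance_of` (the skeleton audit admits a hypothesis whose head's last
name component is a declared stub). -/
namespace Registered

abbrev stub_avoidanceLimitExists : Prop := AvoidanceLimitExists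
abbrev stub_rotationInvariantLimits : Prop :=
  AvoidanceLimitExists → ApproxIndependentLimits → AcuteRotationInvariantLimits
abbrev stub_conformalOfSimilarity : Prop := ConformalOfSimilarity

end Registered

/-- STUB 1 (XL, open — engine deliverable 1): existence of the full-filter avoidance limits
(`AvoidanceLimitExists`, literal). -/
theorem stub_avoidanceLimitExists :
    ∀ (D D' : DobrushinDomain) (a b : ℝ → Site 2), SAW.IsEndpointApprox D a b →
      D'.carrier ⊆ D.carrier → D'.pt 0 = D.pt 0 → D'.pt 1 = D.pt 1 →
      (∃ ε : ℝ, 0 < ε ∧ D'.carrier ∩ Metric.ball (D.pt 0) ε = D.carrier ∩ Metric.ball (D.pt 0) ε ∧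
        D'.carrier ∩ Metric.ball (D.pt 1) ε = D.carrier ∩ Metric.ball (D.pt 1) ε) →
      ∃ r : ENNReal,
        Tendsto (fun δ => ((SAW.law D.carrier δ (a δ) (b δ)).map (fun γ => γ.curve))
            (CurveClass.rangeSubset (closure D'.carrier))) (𝓝[>] 0) (𝓝 r) := by
  sorry

/-- STUB 2d (XL, open — engine deliverable 2 proper, SHARP): existence + approximation independence ⇒
invariance of the limit values under rotations by `θ ∈ [0, π/2)`
(`AvoidanceLimitExists → ApproxIndependentLimits → AcuteRotationInvariantLimits`, literal). At `θ = 0` this is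
the hypothesis; for `θ ∈ (0, π/2)` it is the emergent isotropy of the critical ℤ² SAW (open; nothing in print —
for FK percolation the analogue is the DKKMO 2020 rotation-invariance theorem). -/
theorem stub_rotationInvariantLimits :
    (∀ (D D' : DobrushinDomain) (a b : ℝ → Site 2), SAW.IsEndpointApprox D a b →
       D'.carrier ⊆ D.carrier → D'.pt 0 = D.pt 0 → D'.pt 1 = D.pt 1 →
       (∃ ε : ℝ, 0 < ε ∧ D'.carrier ∩ Metric.ball (D.pt 0) ε = D.carrier ∩ Metric.ball (D.pt 0) ε ∧
         D'.carrier ∩ Metric.ball (D.pt 1) ε = D.carrier ∩ Metric.ball (D.pt 1) ε) →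
       ∃ r : ENNReal,
         Tendsto (fun δ => ((SAW.law D.carrier δ (a δ) (b δ)).map (fun γ => γ.curve))
             (CurveClass.rangeSubset (closure D'.carrier))) (𝓝[>] 0) (𝓝 r)) →
    (∀ (D D' : DobrushinDomain) (a b c d : ℝ → Site 2),
       SAW.IsEndpointApprox D a b → SAW.IsEndpointApprox D c d →
       D'.carrier ⊆ D.carrier → D'.pt 0 = D.pt 0 → D'.pt 1 = D.pt 1 →
       (∃ ε : ℝ, 0 < ε ∧ D'.carrier ∩ Metric.ball (D.pt 0) ε = D.carrier ∩ Metric.ball (D.pt 0) ε ∧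
         D'.carrier ∩ Metric.ball (D.pt 1) ε = D.carrier ∩ Metric.ball (D.pt 1) ε) →
       ∀ r₁ r₂ : ENNReal,
         Tendsto (fun δ => ((SAW.law D.carrier δ (a δ) (b δ)).map (fun γ => γ.curve))
             (CurveClass.rangeSubset (closure D'.carrier))) (𝓝[>] 0) (𝓝 r₁) →
         Tendsto (fun δ => ((SAW.law D.carrier δ (c δ) (d δ)).map (fun γ => γ.curve))
             (CurveClass.rangeSubset (closure D'.carrier))) (𝓝[>] 0) (𝓝 r₂) → r₁ = r₂) →
    ∀ (D D' E E' : DobrushinDomain) (a b c d : ℝ → Site 2) (θ : ℝ) (hθ : Complex.exp ((θ : ℂ) * Complex.I) ≠ 0),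
      0 ≤ θ → θ < Real.pi / 2 →
      SAW.IsEndpointApprox D a b → SAW.IsEndpointApprox E c d →
      D'.carrier ⊆ D.carrier → D'.pt 0 = D.pt 0 → D'.pt 1 = D.pt 1 →
      (∃ ε : ℝ, 0 < ε ∧ D'.carrier ∩ Metric.ball (D.pt 0) ε = D.carrier ∩ Metric.ball (D.pt 0) ε ∧
        D'.carrier ∩ Metric.ball (D.pt 1) ε = D.carrier ∩ Metric.ball (D.pt 1) ε) →
      E'.carrier ⊆ E.carrier → E'.pt 0 = E.pt 0 → E'.pt 1 = E.pt 1 →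
      (∃ ε : ℝ, 0 < ε ∧ E'.carrier ∩ Metric.ball (E.pt 0) ε = E.carrier ∩ Metric.ball (E.pt 0) ε ∧
        E'.carrier ∩ Metric.ball (E.pt 1) ε = E.carrier ∩ Metric.ball (E.pt 1) ε) →
      E.carrier = (similarity (Complex.exp ((θ : ℂ) * Complex.I)) hθ 0) '' D.carrier →
      E'.carrier = (similarity (Complex.exp ((θ : ℂ) * Complex.I)) hθ 0) '' D'.carrier →
      E.pt 0 = (similarity (Complex.exp ((θ : ℂ) * Complex.I)) hθ 0) (D.pt 0) → E.pt 1 = (similarity (Complex.exp ((θ : ℂ) * Complex.I)) hθ 0) (D.pt 1) →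
      ∀ r₁ r₂ : ENNReal,
        Tendsto (fun δ => ((SAW.law D.carrier δ (a δ) (b δ)).map (fun γ => γ.curve))
            (CurveClass.rangeSubset (closure D'.carrier))) (𝓝[>] 0) (𝓝 r₁) →
        Tendsto (fun δ => ((SAW.law E.carrier δ (c δ) (d δ)).map (fun γ => γ.curve))
            (CurveClass.rangeSubset (closure E'.carrier))) (𝓝[>] 0) (𝓝 r₂) → r₁ = r₂ := by
  sorry

/-- STUB 3 (XXL, open — the HARDEST, residual N3; held by the lead): existence + similarity invariance ⇒
conformal invariance (`ConformalOfSimilarity`, literal). -/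
theorem stub_conformalOfSimilarity :
    (∀ (D D' : DobrushinDomain) (a b : ℝ → Site 2), SAW.IsEndpointApprox D a b →
       D'.carrier ⊆ D.carrier → D'.pt 0 = D.pt 0 → D'.pt 1 = D.pt 1 →
       (∃ ε : ℝ, 0 < ε ∧ D'.carrier ∩ Metric.ball (D.pt 0) ε = D.carrier ∩ Metric.ball (D.pt 0) ε ∧
         D'.carrier ∩ Metric.ball (D.pt 1) ε = D.carrier ∩ Metric.ball (D.pt 1) ε) →
       ∃ r : ENNReal,
         Tendsto (fun δ => ((SAW.law D.carrier δ (a δ) (b δ)).map (fun γ => γ.curve))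
             (CurveClass.rangeSubset (closure D'.carrier))) (𝓝[>] 0) (𝓝 r)) →
    (∀ (D D' E E' : DobrushinDomain) (a b c d : ℝ → Site 2) (g : ConformalEquiv D.carrier E.carrier),
       (∃ (s θ : ℝ) (w : ℂ), 0 < s ∧ ∀ z ∈ D.carrier,
         g z = (s : ℂ) * Complex.exp ((θ : ℂ) * Complex.I) * z + w) →
       SAW.IsEndpointApprox D a b → SAW.IsEndpointApprox E c d →
       D'.carrier ⊆ D.carrier → D'.pt 0 = D.pt 0 → D'.pt 1 = D.pt 1 →
       (∃ ε : ℝ, 0 < ε ∧ D'.carrier ∩ Metric.ball (D.pt 0) ε = D.carrier ∩ Metric.ball (D.pt 0) ε ∧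
         D'.carrier ∩ Metric.ball (D.pt 1) ε = D.carrier ∩ Metric.ball (D.pt 1) ε) →
       E'.carrier ⊆ E.carrier → E'.pt 0 = E.pt 0 → E'.pt 1 = E.pt 1 →
       (∃ ε : ℝ, 0 < ε ∧ E'.carrier ∩ Metric.ball (E.pt 0) ε = E.carrier ∩ Metric.ball (E.pt 0) ε ∧
         E'.carrier ∩ Metric.ball (E.pt 1) ε = E.carrier ∩ Metric.ball (E.pt 1) ε) →
       g.HasBoundaryValue (D.pt 0) (E.pt 0) → g.HasBoundaryValue (D.pt 1) (E.pt 1) →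
       g '' D'.carrier = E'.carrier →
       ∀ r₁ r₂ : ENNReal,
         Tendsto (fun δ => ((SAW.law D.carrier δ (a δ) (b δ)).map (fun γ => γ.curve))
             (CurveClass.rangeSubset (closure D'.carrier))) (𝓝[>] 0) (𝓝 r₁) →
         Tendsto (fun δ => ((SAW.law E.carrier δ (c δ) (d δ)).map (fun γ => γ.curve))
             (CurveClass.rangeSubset (closure E'.carrier))) (𝓝[>] 0) (𝓝 r₂) → r₁ = r₂) →
    ∀ (D D' E E' : DobrushinDomain) (a b c d : ℝ → Site 2) (g : ConformalEquiv D.carrier E.carrier),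
      SAW.IsEndpointApprox D a b → SAW.IsEndpointApprox E c d →
      D'.carrier ⊆ D.carrier → D'.pt 0 = D.pt 0 → D'.pt 1 = D.pt 1 →
      (∃ ε : ℝ, 0 < ε ∧ D'.carrier ∩ Metric.ball (D.pt 0) ε = D.carrier ∩ Metric.ball (D.pt 0) ε ∧
        D'.carrier ∩ Metric.ball (D.pt 1) ε = D.carrier ∩ Metric.ball (D.pt 1) ε) →
      E'.carrier ⊆ E.carrier → E'.pt 0 = E.pt 0 → E'.pt 1 = E.pt 1 →
      (∃ ε : ℝ, 0 < ε ∧ E'.carrier ∩ Metric.ball (E.pt 0) ε = E.carrier ∩ Metric.ball (E.pt 0) ε ∧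
        E'.carrier ∩ Metric.ball (E.pt 1) ε = E.carrier ∩ Metric.ball (E.pt 1) ε) →
      g.HasBoundaryValue (D.pt 0) (E.pt 0) → g.HasBoundaryValue (D.pt 1) (E.pt 1) →
      g '' D'.carrier = E'.carrier →
      ∀ r₁ r₂ : ENNReal,
        Tendsto (fun δ => ((SAW.law D.carrier δ (a δ) (b δ)).map (fun γ => γ.curve))
            (CurveClass.rangeSubset (closure D'.carrier))) (𝓝[>] 0) (𝓝 r₁) →
        Tendsto (fun δ => ((SAW.law E.carrier δ (c δ) (d δ)).map (fun γ => γ.curve))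
            (CurveClass.rangeSubset (closure E'.carrier))) (𝓝[>] 0) (𝓝 r₂) → r₁ = r₂ := by
  sorry

/-! The literal stubs are, by term identity, the named statements of §1. -/
example : AvoidanceLimitExists := stub_avoidanceLimitExists
example : AvoidanceLimitExists → ApproxIndependentLimits :=
  _root_.Summit.CriticalPhenomena.SAWScalingLimit.Theorems.ConformalAvoidance.stub_approxIndependentLimits
example : AvoidanceLimitExists → ApproxIndependentLimits → TranslationInvariantLimits :=
  _root_.Summit.CriticalPhenomena.SAWScalingLimit.Theorems.ConformalAvoidance.stub_translationInvariantLimits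
example : ApproxIndependentLimits → DilationInvariantLimits :=
  _root_.Summit.CriticalPhenomena.SAWScalingLimit.Theorems.ConformalAvoidance.stub_dilationInvariantLimits
example : ApproxIndependentLimits → QuarterTurnInvariantLimits :=
  _root_.Summit.CriticalPhenomena.SAWScalingLimit.Theorems.ConformalAvoidance.stub_quarterTurnInvariantLimits
example : QuarterTurnInvariantLimits → InvariantUnder Complex.I Complex.I_ne_zero := id
example : AvoidanceLimitExists → ApproxIndependentLimits → AcuteRotationInvariantLimits :=
  stub_rotationInvariantLimits
example : ConformalOfSimilarity := stub_conformalOfSimilarity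

/-! ## 3. Glue and composition: the registered stubs imply the crux, BY NAME (kernel-checked, no `sorry`) -/

/-! ### Glue (lead, proved): the parts give similarity invariance -/

/-- A plane similarity `z ↦ c z + v` maps the ball `B(p, ε)` onto the ball `B(c p + v, ‖c‖ ε)`.
[folklore] -/
theorem image_similarity_ball (c : ℂ) (hc : c ≠ 0) (v p : ℂ) (ε : ℝ) :
    similarity c hc v '' Metric.ball p ε = Metric.ball (similarity c hc v p) (‖c‖ * ε) := by
  have hc' : 0 < ‖c‖ := norm_pos_iff.2 hc
  ext z
  simp only [mem_image, Metric.mem_ball, similarity_apply]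
  constructor
  · rintro ⟨y, hy, rfl⟩
    rw [dist_add_right, dist_eq_norm, ← mul_sub, norm_mul, ← dist_eq_norm]
    exact mul_lt_mul_of_pos_left hy hc'
  · intro hz
    refine ⟨c⁻¹ * (z - v), ?_, ?_⟩
    · rw [dist_eq_norm] at hz ⊢
      have h1 : c⁻¹ * (z - v) - p = c⁻¹ * (z - (c * p + v)) := by
        field_simp
        ring
      rw [h1, norm_mul, norm_inv, inv_mul_lt_iff₀ hc']
      exact hz
    · field_simp
      ring

/-- **Transport of the hull clauses under a plane similarity.** If `D' ⊆ D` have the same marked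
points and agree in balls around them, the same holds for the images `φ D' ⊆ φ D` under
`φ : z ↦ c z + v` (radius scaled by `‖c‖`). [folklore] -/
theorem hull_map (c : ℂ) (hc : c ≠ 0) (v : ℂ) {D D' : DobrushinDomain}
    (hsub : D'.carrier ⊆ D.carrier) (h0 : D'.pt 0 = D.pt 0) (h1 : D'.pt 1 = D.pt 1)
    (hball : ∃ ε : ℝ, 0 < ε ∧
      D'.carrier ∩ Metric.ball (D.pt 0) ε = D.carrier ∩ Metric.ball (D.pt 0) ε ∧
      D'.carrier ∩ Metric.ball (D.pt 1) ε = D.carrier ∩ Metric.ball (D.pt 1) ε) :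
    (D'.map (similarity c hc v)).carrier ⊆ (D.map (similarity c hc v)).carrier ∧
    (D'.map (similarity c hc v)).pt 0 = (D.map (similarity c hc v)).pt 0 ∧
    (D'.map (similarity c hc v)).pt 1 = (D.map (similarity c hc v)).pt 1 ∧
    (∃ ε : ℝ, 0 < ε ∧
      (D'.map (similarity c hc v)).carrier ∩ Metric.ball ((D.map (similarity c hc v)).pt 0) ε =
        (D.map (similarity c hc v)).carrier ∩ Metric.ball ((D.map (similarity c hc v)).pt 0) ε ∧
      (D'.map (similarity c hc v)).carrier ∩ Metric.ball ((D.map (similarity c hc v)).pt 1) ε =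
        (D.map (similarity c hc v)).carrier ∩ Metric.ball ((D.map (similarity c hc v)).pt 1) ε) := by
  obtain ⟨ε, hε, hb0, hb1⟩ := hball
  set φ := similarity c hc v with hφ
  have key : ∀ p : ℂ, D'.carrier ∩ Metric.ball p ε = D.carrier ∩ Metric.ball p ε →
      φ '' D'.carrier ∩ Metric.ball (φ p) (‖c‖ * ε) = φ '' D.carrier ∩ Metric.ball (φ p) (‖c‖ * ε) := by
    intro p hp
    rw [← image_similarity_ball c hc v p ε, ← image_inter φ.injective, ← image_inter φ.injective, hp]
  refine ⟨image_mono hsub, ?_, ?_, ‖c‖ * ε, mul_pos (norm_pos_iff.2 hc) hε, ?_, ?_⟩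
  · simp only [MarkedDomain.pt_map, h0]
  · simp only [MarkedDomain.pt_map, h1]
  · simpa only [MarkedDomain.carrier_map, MarkedDomain.pt_map] using key (D.pt 0) hb0
  · simpa only [MarkedDomain.carrier_map, MarkedDomain.pt_map] using key (D.pt 1) hb1

/-- **Marked points from boundary values.** If the conformal `g : D → E` agrees on `D.carrier` with
the plane similarity `z ↦ c z + v` and has boundary value `q` at a point `p ∈ closure D`, then
`q = c p + v` (limits along the proper filter `𝓝[D] p` are unique). [folklore] -/
theorem eq_of_hasBoundaryValue_of_eqOn {D E : DobrushinDomain} (g : ConformalEquiv D.carrier E.carrier)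
    {c v p q : ℂ} (hg : ∀ z ∈ D.carrier, g z = c * z + v) (hp : p ∈ closure D.carrier)
    (hb : g.HasBoundaryValue p q) : q = c * p + v := by
  haveI : (𝓝[D.carrier] p).NeBot := mem_closure_iff_nhdsWithin_neBot.1 hp
  have hA : Tendsto (fun z : ℂ => c * z + v) (𝓝[D.carrier] p) (𝓝 (c * p + v)) :=
    ((continuous_const.mul continuous_id).add continuous_const).continuousAt.tendsto.mono_left
      nhdsWithin_le_nhds
  have hg' : Tendsto (fun z : ℂ => c * z + v) (𝓝[D.carrier] p) (𝓝 q) :=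
    (show Tendsto g (𝓝[D.carrier] p) (𝓝 q) from hb).congr'
      (eventually_nhdsWithin_of_forall fun z hz => hg z hz)
  exact tendsto_nhds_unique hg' hA

/-- The marked points of a Dobrushin domain lie in the closure of its carrier. [folklore] -/
theorem pt_mem_closure (D : DobrushinDomain) (i : Fin 2) : D.pt i ∈ closure D.carrier :=
  frontier_subset_closure (D.pt_mem_frontier i)

/-- **Invariance under the iterated quarter turns `z ↦ iᵐ z`** from existence (stub 1), approximation
independence (2a) and quarter-turn invariance (2q): induction on `m` through the intermediate domain
`iᵐ D` (`MarkedDomain.map`; hull clauses by `hull_map`, endpoint approximation by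
`SAW.exists_isEndpointApprox`, its limit by stub 1); `m = 0` is approximation independence. [folklore] -/
theorem invariantUnder_I_pow (hALE : AvoidanceLimitExists) (hAIL : ApproxIndependentLimits)
    (hQIL : QuarterTurnInvariantLimits) :
    ∀ m : ℕ, InvariantUnder (Complex.I ^ m) (pow_ne_zero m Complex.I_ne_zero) := by
  intro m
  induction m with
  | zero =>
    intro D D' E E' a b c d hab hcd hsub h0 h1 hball _ _ _ _ hE hE' hEp0 hEp1 r₁ r₂ hr₁ hr₂
    have hid : ∀ X : Set ℂ, (similarity (Complex.I ^ 0) (pow_ne_zero 0 Complex.I_ne_zero) 0) '' X = X :=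
      fun X => by
        ext z
        simp
    rw [hid] at hE hE'
    simp only [similarity_apply, pow_zero, one_mul, add_zero] at hEp0 hEp1
    rw [hE, hE'] at hr₂
    exact hAIL D D' a b c d hab (hcd.congr hE hEp0 hEp1) hsub h0 h1 hball r₁ r₂ hr₁ hr₂
  | succ m ih =>
    intro D D' E E' a b c d hab hcd hsub h0 h1 hball hEsub hE0 hE1 hEball hE hE' hEp0 hEp1 r₁ r₂ hr₁ hr₂
    set ρ : ℂ ≃ₜ ℂ := similarity (Complex.I ^ m) (pow_ne_zero m Complex.I_ne_zero) 0 with hρ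
    set ι : ℂ ≃ₜ ℂ := similarity Complex.I Complex.I_ne_zero 0 with hι
    have hfac : ∀ z : ℂ,
        similarity (Complex.I ^ (m + 1)) (pow_ne_zero (m + 1) Complex.I_ne_zero) 0 z = ι (ρ z) := by
      intro z
      simp only [hρ, hι, similarity_apply, pow_succ]
      ring
    set D₁ : DobrushinDomain := D.map ρ with hD₁
    set D₁' : DobrushinDomain := D'.map ρ with hD₁'
    obtain ⟨hsub₁, h0₁, h1₁, hball₁⟩ := hull_map (Complex.I ^ m) (pow_ne_zero m Complex.I_ne_zero) 0
      hsub h0 h1 hball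
    obtain ⟨e, f, he⟩ := SAW.exists_isEndpointApprox D₁
    obtain ⟨t, ht⟩ := hALE D₁ D₁' e f he hsub₁ h0₁ h1₁ hball₁
    have hfirst : r₁ = t :=
      ih D D' D₁ D₁' a b e f hab he hsub h0 h1 hball hsub₁ h0₁ h1₁ hball₁ (MarkedDomain.carrier_map _ _)
        (MarkedDomain.carrier_map _ _) (MarkedDomain.pt_map _ _ _) (MarkedDomain.pt_map _ _ _) r₁ t hr₁ ht
    have hEcar : E.carrier = ι '' D₁.carrier := by
      rw [hE, hD₁, MarkedDomain.carrier_map, image_image]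
      exact image_congr fun z _ => hfac z
    have hE'car : E'.carrier = ι '' D₁'.carrier := by
      rw [hE', hD₁', MarkedDomain.carrier_map, image_image]
      exact image_congr fun z _ => hfac z
    have hEpt0 : E.pt 0 = ι (D₁.pt 0) := by rw [hEp0, hfac, hD₁, MarkedDomain.pt_map]
    have hEpt1 : E.pt 1 = ι (D₁.pt 1) := by rw [hEp1, hfac, hD₁, MarkedDomain.pt_map]
    have hsecond : t = r₂ :=
      hQIL D₁ D₁' E E' e f c d he hcd hsub₁ h0₁ h1₁ hball₁ hEsub hE0 hE1 hEball hEcar hE'car hEpt0 hEpt1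
        t r₂ ht hr₂
    rw [hfirst, hsecond]

/-- `e^{iπ/2} = i`. [folklore] -/
theorem exp_pi_div_two_mul_I : Complex.exp ((Real.pi / 2 : ℝ) * Complex.I) = Complex.I := by
  rw [Complex.exp_mul_I]
  push_cast
  rw [Complex.cos_pi_div_two, Complex.sin_pi_div_two]
  ring

/-- **Angle bookkeeping**: every `θ` is `θ' + k·(π/2)` with `θ' ∈ [0, π/2)`, `k ∈ ℤ`, and then
`e^{iθ} = e^{iθ'} · i^m` with `m = k mod 4 ∈ ℕ`. [folklore] -/
theorem exists_acute_decomposition (θ : ℝ) :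
    ∃ (θ' : ℝ) (m : ℕ), 0 ≤ θ' ∧ θ' < Real.pi / 2 ∧
      Complex.exp ((θ : ℂ) * Complex.I) = Complex.exp ((θ' : ℂ) * Complex.I) * Complex.I ^ m := by
  set q : ℝ := Real.pi / 2 with hq
  have hq0 : 0 < q := by rw [hq]; positivity
  set k : ℤ := ⌊θ / q⌋ with hk
  refine ⟨θ - k * q, (k % 4).toNat, ?_, ?_, ?_⟩
  · have h := Int.floor_le (θ / q)
    rw [← hk] at h
    have : (k : ℝ) * q ≤ θ := by rwa [le_div_iff₀ hq0] at h
    linarith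
  · have h := Int.lt_floor_add_one (θ / q)
    rw [← hk] at h
    have : θ < ((k : ℝ) + 1) * q := by rwa [div_lt_iff₀ hq0] at h
    linarith
  · have hm0 : 0 ≤ k % 4 := Int.emod_nonneg k (by norm_num)
    have hkm : ((k % 4).toNat : ℤ) = k % 4 := Int.toNat_of_nonneg hm0
    have hdecomp : (k : ℝ) = 4 * ((k / 4 : ℤ) : ℝ) + (((k % 4).toNat : ℕ) : ℝ) := by
      have h := Int.emod_add_mul_ediv k 4
      have h' : (k : ℝ) = ((k % 4 : ℤ) : ℝ) + 4 * ((k / 4 : ℤ) : ℝ) := by exact_mod_cast h.symm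
      rw [h']
      have : ((k % 4 : ℤ) : ℝ) = (((k % 4).toNat : ℕ) : ℝ) := by exact_mod_cast hkm.symm
      rw [this]
      ring
    have hθ : (θ : ℂ) * Complex.I = ((θ - k * q : ℝ) : ℂ) * Complex.I +
        ((k / 4 : ℤ) : ℂ) * (2 * Real.pi * Complex.I) + (((k % 4).toNat : ℕ) : ℂ) * ((q : ℂ) * Complex.I) := by
      have hθ' : (θ : ℝ) = (θ - k * q) + (4 * ((k / 4 : ℤ) : ℝ) + (((k % 4).toNat : ℕ) : ℝ)) * q := by
        rw [← hdecomp]; ring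
      have hπ : (Real.pi : ℂ) = 2 * (q : ℂ) := by rw [hq]; push_cast; ring
      conv_lhs => rw [hθ']
      push_cast
      rw [hπ]
      ring
    rw [hθ, Complex.exp_add, Complex.exp_add, Complex.exp_int_mul_two_pi_mul_I, mul_one,
      Complex.exp_nat_mul, hq, exp_pi_div_two_mul_I]

/-- **Rotation invariance for every angle** from existence (stub 1), approximation independence (2a),
quarter-turn invariance (2q) and invariance under rotations by `θ ∈ [0, π/2)` (2d): write
`e^{iθ} = e^{iθ'} i^m` (`exists_acute_decomposition`) and pass through the intermediate domain `i^m D`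
(`invariantUnder_I_pow`, then 2d from `i^m D` to `E`). [folklore] -/
theorem rotationInvariantLimits_of_parts (hALE : AvoidanceLimitExists) (hAIL : ApproxIndependentLimits)
    (hQIL : QuarterTurnInvariantLimits) (hARIL : AcuteRotationInvariantLimits) :
    RotationInvariantLimits := by
  intro D D' E E' a b c d θ hθ hab hcd hsub h0 h1 hball hEsub hE0 hE1 hEball hE hE' hEp0 hEp1 r₁ r₂ hr₁ hr₂
  obtain ⟨θ', m, hθ'0, hθ'1, hexp⟩ := exists_acute_decomposition θ
  have hθ' : Complex.exp ((θ' : ℂ) * Complex.I) ≠ 0 := Complex.exp_ne_zero _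
  set ρ : ℂ ≃ₜ ℂ := similarity (Complex.I ^ m) (pow_ne_zero m Complex.I_ne_zero) 0 with hρ
  set κ : ℂ ≃ₜ ℂ := similarity (Complex.exp ((θ' : ℂ) * Complex.I)) hθ' 0 with hκ
  have hfac : ∀ z : ℂ, similarity (Complex.exp ((θ : ℂ) * Complex.I)) hθ 0 z = κ (ρ z) := by
    intro z
    simp only [hρ, hκ, similarity_apply, hexp]
    ring
  set D₁ : DobrushinDomain := D.map ρ with hD₁
  set D₁' : DobrushinDomain := D'.map ρ with hD₁'
  obtain ⟨hsub₁, h0₁, h1₁, hball₁⟩ := hull_map (Complex.I ^ m) (pow_ne_zero m Complex.I_ne_zero) 0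
    hsub h0 h1 hball
  obtain ⟨e, f, he⟩ := SAW.exists_isEndpointApprox D₁
  obtain ⟨t, ht⟩ := hALE D₁ D₁' e f he hsub₁ h0₁ h1₁ hball₁
  have hfirst : r₁ = t :=
    invariantUnder_I_pow hALE hAIL hQIL m D D' D₁ D₁' a b e f hab he hsub h0 h1 hball hsub₁ h0₁ h1₁ hball₁
      (MarkedDomain.carrier_map _ _) (MarkedDomain.carrier_map _ _) (MarkedDomain.pt_map _ _ _)
      (MarkedDomain.pt_map _ _ _) r₁ t hr₁ ht
  have hEcar : E.carrier = κ '' D₁.carrier := by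
    rw [hE, hD₁, MarkedDomain.carrier_map, image_image]
    exact image_congr fun z _ => hfac z
  have hE'car : E'.carrier = κ '' D₁'.carrier := by
    rw [hE', hD₁', MarkedDomain.carrier_map, image_image]
    exact image_congr fun z _ => hfac z
  have hEpt0 : E.pt 0 = κ (D₁.pt 0) := by rw [hEp0, hfac, hD₁, MarkedDomain.pt_map]
  have hEpt1 : E.pt 1 = κ (D₁.pt 1) := by rw [hEp1, hfac, hD₁, MarkedDomain.pt_map]
  have hsecond : t = r₂ :=
    hARIL D₁ D₁' E E' e f c d θ' hθ' hθ'0 hθ'1 he hcd hsub₁ h0₁ h1₁ hball₁ hEsub hE0 hE1 hEball hEcar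
      hE'car hEpt0 hEpt1 t r₂ ht hr₂
  rw [hfirst, hsecond]


/-- **Stub 2 of the birth skeleton from the parts** (r1's `stub_similarityOfParts`, proved): existence
(stub 1), approximation independence (2a), translation (2b), dilation (2c) and rotation (2d) invariance of
the limit values give their invariance under every plane similarity `g(z) = s e^{iθ} z + w`, `s > 0`,
between two crux configurations with the crux's boundary data. Factor
`g = (· + w) ∘ (s ·) ∘ (e^{iθ} ·)` through `D₁ = e^{iθ} D`, `D₂ = s D₁` (`MarkedDomain.map`), whose
endpoint approximations exist (`SAW.exists_isEndpointApprox`) and whose limits exist by stub 1; chain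
the three invariances; the marked points of `E` are read off the boundary values of `g`. [folklore] -/
theorem similarityInvariantLimits_of_parts (h₁ : Registered.stub_avoidanceLimitExists)
    (h2d : Registered.stub_rotationInvariantLimits) :
    SimilarityInvariantLimits := by
  have hALE : AvoidanceLimitExists := h₁
  have hAIL : ApproxIndependentLimits := _root_.Summit.CriticalPhenomena.SAWScalingLimit.Theorems.ConformalAvoidance.stub_approxIndependentLimits h₁
  have hTIL : TranslationInvariantLimits := _root_.Summit.CriticalPhenomena.SAWScalingLimit.Theorems.ConformalAvoidance.stub_translationInvariantLimits h₁ hAIL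
  have hDIL : DilationInvariantLimits := _root_.Summit.CriticalPhenomena.SAWScalingLimit.Theorems.ConformalAvoidance.stub_dilationInvariantLimits hAIL
  have hRIL : RotationInvariantLimits :=
    rotationInvariantLimits_of_parts h₁ hAIL (_root_.Summit.CriticalPhenomena.SAWScalingLimit.Theorems.ConformalAvoidance.stub_quarterTurnInvariantLimits hAIL) (h2d h₁ hAIL)
  intro D D' E E' a b c d g hg hab hcd hsub h0 h1 hball hEsub hE0 hE1 hEball hg0 hg1 hgD' r₁ r₂ hr₁ hr₂
  obtain ⟨s, θ, w, hs, hg⟩ := hg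
  -- the three factors of `g`
  have hθ : Complex.exp ((θ : ℂ) * Complex.I) ≠ 0 := Complex.exp_ne_zero _
  have hs' : (s : ℂ) ≠ 0 := Complex.ofReal_ne_zero.2 hs.ne'
  set ρ : ℂ ≃ₜ ℂ := similarity (Complex.exp ((θ : ℂ) * Complex.I)) hθ 0 with hρ
  set σ : ℂ ≃ₜ ℂ := similarity (s : ℂ) hs' 0 with hσ
  set τ : ℂ ≃ₜ ℂ := similarity 1 one_ne_zero w with hτ
  have hfac : ∀ z : ℂ, τ (σ (ρ z)) = (s : ℂ) * Complex.exp ((θ : ℂ) * Complex.I) * z + w := by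
    intro z
    simp only [hρ, hσ, hτ, similarity_apply]
    ring
  -- intermediate domains
  set D₁ : DobrushinDomain := D.map ρ with hD₁
  set D₁' : DobrushinDomain := D'.map ρ with hD₁'
  set D₂ : DobrushinDomain := D₁.map σ with hD₂
  set D₂' : DobrushinDomain := D₁'.map σ with hD₂'
  obtain ⟨hsub₁, h0₁, h1₁, hball₁⟩ :=
    hull_map (Complex.exp ((θ : ℂ) * Complex.I)) hθ 0 hsub h0 h1 hball
  obtain ⟨hsub₂, h0₂, h1₂, hball₂⟩ := hull_map (s : ℂ) hs' 0 hsub₁ h0₁ h1₁ hball₁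
  -- endpoint approximations and limits in the intermediate domains
  obtain ⟨e₁, f₁, he₁⟩ := SAW.exists_isEndpointApprox D₁
  obtain ⟨e₂, f₂, he₂⟩ := SAW.exists_isEndpointApprox D₂
  obtain ⟨t₁, ht₁⟩ := hALE D₁ D₁' e₁ f₁ he₁ hsub₁ h0₁ h1₁ hball₁
  obtain ⟨t₂, ht₂⟩ := hALE D₂ D₂' e₂ f₂ he₂ hsub₂ h0₂ h1₂ hball₂
  -- rotation: `r₁ = t₁`
  have hrot : r₁ = t₁ :=
    hRIL D D' D₁ D₁' a b e₁ f₁ θ hθ hab he₁ hsub h0 h1 hball hsub₁ h0₁ h1₁ hball₁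
      (MarkedDomain.carrier_map _ _) (MarkedDomain.carrier_map _ _) (MarkedDomain.pt_map _ _ _)
      (MarkedDomain.pt_map _ _ _) r₁ t₁ hr₁ ht₁
  -- dilation: `t₁ = t₂`
  have hdil : t₁ = t₂ :=
    hDIL D₁ D₁' D₂ D₂' e₁ f₁ e₂ f₂ s hs' hs he₁ he₂ hsub₁ h0₁ h1₁ hball₁ hsub₂ h0₂ h1₂ hball₂
      (MarkedDomain.carrier_map _ _) (MarkedDomain.carrier_map _ _) (MarkedDomain.pt_map _ _ _)
      (MarkedDomain.pt_map _ _ _) t₁ t₂ ht₁ ht₂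
  -- translation: `t₂ = r₂`; first the data of `E` in terms of `D₂`
  have hgfac : EqOn g (fun z => τ (σ (ρ z))) D.carrier := fun z hz => by
    show _ = τ (σ (ρ z))
    rw [hfac z]
    exact hg z hz
  have hEcar : E.carrier = τ '' D₂.carrier := by
    rw [← g.bijOn.image_eq, hgfac.image_eq, hD₂, MarkedDomain.carrier_map, hD₁,
      MarkedDomain.carrier_map, image_image, image_image]
  have hE'car : E'.carrier = τ '' D₂'.carrier := by
    rw [← hgD', (hgfac.mono hsub).image_eq, hD₂', MarkedDomain.carrier_map, hD₁',
      MarkedDomain.carrier_map, image_image, image_image]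
  have hEpt0 : E.pt 0 = τ (D₂.pt 0) := by
    rw [hD₂, MarkedDomain.pt_map, hD₁, MarkedDomain.pt_map, hfac]
    exact eq_of_hasBoundaryValue_of_eqOn g hg (pt_mem_closure D 0) hg0
  have hEpt1 : E.pt 1 = τ (D₂.pt 1) := by
    rw [hD₂, MarkedDomain.pt_map, hD₁, MarkedDomain.pt_map, hfac]
    exact eq_of_hasBoundaryValue_of_eqOn g hg (pt_mem_closure D 1) hg1
  have htra : t₂ = r₂ :=
    hTIL D₂ D₂' E E' e₂ f₂ c d w he₂ hcd hsub₂ h0₂ h1₂ hball₂ hEsub hE0 hE1 hEball hEcar hE'car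
      hEpt0 hEpt1 t₂ r₂ ht₂ hr₂
  rw [hrot, hdil, htra]

/-- **`ConformalAvoidance_of`**: the three registered stubs (+ the landed ones, imported) imply `SAWTensorRG.ConformalAvoidance`. Given the
crux data, existence (stub 1) at `(D, D'; a, b)` and at `(E, E'; c, d)` gives limits `r₁`, `r₂`; N3 (stub 3)
fed existence and similarity invariance (glued from 1, 2a–2d, 2q) gives the conformal invariance of limit values,
whence `r₁ = r₂`, and `r := r₁` serves both convergences. -/
theorem ConformalAvoidance_of (h₁ : Registered.stub_avoidanceLimitExists)
    
    (h2d : Registered.stub_rotationInvariantLimits) (h₃ : Registered.stub_conformalOfSimilarity) :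
    _root_.Summit.CriticalPhenomena.SAWScalingLimit.Theses.SAWTensorRG.ConformalAvoidance := by
  intro D D' E E' a b c d g hab hcd hD'sub hD'0 hD'1 hD'ball hE'sub hE'0 hE'1 hE'ball hg0 hg1 hgD'
  have h₂ : SimilarityInvariantLimits := similarityInvariantLimits_of_parts h₁  h2d
  have hconf : ConformallyInvariantLimits := h₃ h₁ h₂
  obtain ⟨r₁, hr₁⟩ := h₁ D D' a b hab hD'sub hD'0 hD'1 hD'ball
  obtain ⟨r₂, hr₂⟩ := h₁ E E' c d hcd hE'sub hE'0 hE'1 hE'ball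
  have heq : r₁ = r₂ :=
    hconf D D' E E' a b c d g hab hcd hD'sub hD'0 hD'1 hD'ball hE'sub hE'0 hE'1 hE'ball hg0 hg1 hgD'
      r₁ r₂ hr₁ hr₂
  refine ⟨r₁, hr₁, ?_⟩
  rw [heq]
  exact hr₂

/-- Hypothesis-free form: the crux modulo the three sorried stubs. -/
example : _root_.Summit.CriticalPhenomena.SAWScalingLimit.Theses.SAWTensorRG.ConformalAvoidance :=
  ConformalAvoidance_of stub_avoidanceLimitExists 
    stub_rotationInvariantLimits stub_conformalOfSimilarity

end Summit.CriticalPhenomena.SAWScalingLimit.Cruxes.ConformalAvoidance.Birth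

end
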